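import Mathlib.RingTheory.Algebraic.Integral
import Mathlib.Algebra.Polynomial.Roots
import Mathlib.Algebra.Order.Archimedean.Basic
import Literature.NumberTheory.Transcendental.SemialgebraicMapsProofs
import HarnessLib

/-!
# SoloInformed — descent of real-algebraic coefficients to rational coefficients

Solo programme `solo-KontsevichZagierPeriods-informed`, session s137, file 2 (companion of
`SoloInformedAlgebraicParameterTransfer`): the second half of the transfer engine of the `KZ_ℝ`
METHOD BARRIER (paper `real-parameters.md`, THEOREM T).  File 1 turns a configuration of
`ℝ`-semialgebraic data (= fibres of `ℚ`-semialgebraic families at one real parameter vector) whose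
validity is a `ℚ`-semialgebraic condition into one with a real-ALGEBRAIC parameter vector; this file
shows that the resulting data are then literally `ℚ`-semialgebraic — the step "`ℝ_alg`-semialgebraic
`=` `ℚ`-semialgebraic" of THEOREM T's proof (Basu–Pollack–Roy 2006, Thm. 2.77 / Cor. 2.78 with
`D = ℚ`: every real algebraic number is `ℚ`-definable, as the unique root of a rational polynomial
in a rational interval):

* `soloInformed_isSemialgebraic_rat_of_integralClosure` — **a subset of `ℝⁿ` semialgebraic over
  the ring `K = integralClosure ℚ ℝ` of real algebraic numbers is `ℚ`-semialgebraic.**  Proof: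
  spread the coefficients of a generator `{p = 0}` / `{p > 0}`, `p ∈ K[X]`, out as new variables
  `y` (`soloInformed_exists_ratFamily_of_mvPolynomial_coeff`), pin each `y_j` to the coefficient
  `c_j` by "`μ_j(y_j) = 0 ∧ a_j < y_j < b_j`" with `μ_j ∈ ℚ[Y]` and a rational isolating interval
  (`soloInformed_exists_isolating_ratInterval`), and project the `y`'s away by iterated
  Tarski–Seidenberg (`IsSemialgebraic.image_castAdd`):
  `soloInformed_isSemialgebraic_rat_setOf_coeff`.
* `soloInformed_isSemialgebraic_rat_fibre_of_isAlgebraic` — **the fibre `{x | (c, x) ∈ S}` of a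
  `ℚ`-semialgebraic family `S ⊆ ℝ^{m ⊕ n}` at a parameter vector `c` with ALGEBRAIC coordinates is
  `ℚ`-semialgebraic** (with file 1's `soloInformed_isSemialgebraic_real_iff_fibre`: an
  `ℝ`-semialgebraic set presented with algebraic parameters is `ℚ`-semialgebraic).

What stays on PAPER in THEOREM T / THEOREM R is only the first-order-ness of the validity condition
of a `KZ_ℝ` chain (a deep embedding of the move side conditions), not the real algebraic geometry.

References: S. Basu, R. Pollack, M.-F. Roy, *Algorithms in Real Algebraic Geometry* (2006),
§2.4–2.5, Thm. 2.77, Cor. 2.78, Thm. 2.80; J. Bochnak, M. Coste, M.-F. Roy, *Real Algebraic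
Geometry* (1998), §2.1–2.2 and Prop. 5.1.5 ff.
-/

noncomputable section

namespace Summit.KontsevichZagierPeriods.KontsevichZagierPeriods.Theorems

open Set Literature.ModelTheory.ExponentialFields Literature.NumberTheory.Transcendental

/-! ### Spreading out coefficients and isolating algebraic numbers -/

/-- **Spreading out coefficients.** Every `p ∈ k[X₁, …, Xₙ]` over a coefficient ring `k → ℝ` is a
specialisation `p(x) = Q(c, x)` of a polynomial `Q ∈ ℚ[C₁, …, C_m, X₁, …, Xₙ]` with RATIONAL
coefficients at a coefficient vector `c ∈ kᵐ` (induction on `p`). [folklore] -/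
theorem soloInformed_exists_ratFamily_of_mvPolynomial_coeff {k : Type*} [CommRing k] [Algebra k ℝ]
    {n : ℕ} (p : MvPolynomial (Fin n) k) :
    ∃ (m : ℕ) (c : Fin m → k) (Q : MvPolynomial (Fin m ⊕ Fin n) ℚ), ∀ x : Fin n → ℝ,
      MvPolynomial.aeval (Sum.elim (fun j => algebraMap k ℝ (c j)) x) Q =
        MvPolynomial.aeval x p := by
  induction p using MvPolynomial.induction_on with
  | C a =>
    refine ⟨1, fun _ => a, MvPolynomial.X (Sum.inl 0), fun x => ?_⟩
    simp
  | add p q hp hq =>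
    obtain ⟨m₁, c₁, Q₁, h₁⟩ := hp
    obtain ⟨m₂, c₂, Q₂, h₂⟩ := hq
    refine ⟨m₁ + m₂, Fin.append c₁ c₂,
      MvPolynomial.rename (Sum.map (Fin.castAdd m₂) id) Q₁ +
        MvPolynomial.rename (Sum.map (Fin.natAdd m₁) id) Q₂, fun x => ?_⟩
    have e₁ : (Sum.elim (fun j => algebraMap k ℝ (Fin.append c₁ c₂ j)) x) ∘
        Sum.map (Fin.castAdd m₂) id = Sum.elim (fun j => algebraMap k ℝ (c₁ j)) x := by
      funext j
      cases j with
      | inl j => simp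
      | inr j => simp
    have e₂ : (Sum.elim (fun j => algebraMap k ℝ (Fin.append c₁ c₂ j)) x) ∘
        Sum.map (Fin.natAdd m₁) id = Sum.elim (fun j => algebraMap k ℝ (c₂ j)) x := by
      funext j
      cases j with
      | inl j => simp
      | inr j => simp
    rw [map_add, MvPolynomial.aeval_rename, MvPolynomial.aeval_rename, e₁, e₂, h₁, h₂, map_add]
  | mul_X p i hp =>
    obtain ⟨m, c, Q, h⟩ := hp
    refine ⟨m, c, Q * MvPolynomial.X (Sum.inr i), fun x => ?_⟩
    rw [map_mul, map_mul, h x, MvPolynomial.aeval_X, MvPolynomial.aeval_X, Sum.elim_inr]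

/-- **Rational isolating intervals.** A real algebraic number `c` is the ONLY root of some
non-zero `μ ∈ ℚ[Y]` in some rational interval `(a, b) ∋ c` (the real roots of `μ` are finitely
many) — the `ℚ`-definability of real algebraic numbers used in THEOREM T.
[cite: BasuPollackRoy2006, §2.5] -/
theorem soloInformed_exists_isolating_ratInterval {c : ℝ} (hc : IsAlgebraic ℚ c) :
    ∃ (μ : Polynomial ℚ) (a b : ℚ), μ ≠ 0 ∧ (a : ℝ) < c ∧ c < b ∧ Polynomial.aeval c μ = 0 ∧
      ∀ y : ℝ, (a : ℝ) < y → y < b → Polynomial.aeval y μ = 0 → y = c := by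
  obtain ⟨μ, hμ, hroot⟩ := hc
  have hfin : (μ.rootSet ℝ \ {c}).Finite :=
    (Polynomial.rootSet_finite μ ℝ).subset fun y hy => hy.1
  have hopen : (μ.rootSet ℝ \ {c})ᶜ ∈ nhds c := hfin.isClosed.isOpen_compl.mem_nhds (by simp)
  obtain ⟨ε, hε, hball⟩ := Metric.mem_nhds_iff.1 hopen
  obtain ⟨a, ha₁, ha₂⟩ := exists_rat_btwn (show c - ε < c by linarith)
  obtain ⟨b, hb₁, hb₂⟩ := exists_rat_btwn (show c < c + ε by linarith)
  refine ⟨μ, a, b, hμ, ha₂, hb₁, hroot, fun y hay hyb hy => ?_⟩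
  have hyroot : y ∈ μ.rootSet ℝ := Polynomial.mem_rootSet.2 ⟨hμ, hy⟩
  have hyball : y ∈ Metric.ball c ε := by
    rw [Metric.mem_ball, Real.dist_eq, abs_lt]
    constructor <;> linarith
  by_contra hne
  exact hball hyball ⟨hyroot, hne⟩

/-! ### Descent for generators and for all `K`-semialgebraic sets -/

/-- **Descent for one sign condition.** For `p` with real-algebraic coefficients
(`K = integralClosure ℚ ℝ`) and a "sign condition" `rel` whose sets `{u | rel (q u)}` are
`ℚ`-semialgebraic for rational `q` (`rel = (· = 0)` or `(0 < ·)`), the set `{x | rel (p x)}` is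
`ℚ`-semialgebraic: writing `p(x) = Q(c, x)` with `Q` rational and `c ∈ Kᵐ`, it is the projection to
the `x`-coordinates of the `ℚ`-semialgebraic set
`{(x, y) | rel (Q(y, x)) ∧ ∀ j, μ_j(y_j) = 0 ∧ a_j < y_j < b_j}` (isolating data of the `c_j`), and
projections of `ℚ`-semialgebraic sets are `ℚ`-semialgebraic (iterated Tarski–Seidenberg,
`IsSemialgebraic.image_castAdd`). [cite: BasuPollackRoy2006, Thm. 2.77 and Cor. 2.78] -/
theorem soloInformed_isSemialgebraic_rat_setOf_coeff (rel : ℝ → Prop)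
    (hrel : ∀ (N : ℕ) (q : MvPolynomial (Fin N) ℚ),
      IsSemialgebraic ℚ {u : Fin N → ℝ | rel (MvPolynomial.aeval u q)})
    {n : ℕ} (p : MvPolynomial (Fin n) (integralClosure ℚ ℝ)) :
    IsSemialgebraic ℚ {x : Fin n → ℝ | rel (MvPolynomial.aeval x p)} := by
  obtain ⟨m, c, Q, hQ⟩ := soloInformed_exists_ratFamily_of_mvPolynomial_coeff p
  have halg : ∀ j, IsAlgebraic ℚ (algebraMap (integralClosure ℚ ℝ) ℝ (c j)) := fun j =>
    ((mem_integralClosure_iff ℚ ℝ).1 (c j).2).isAlgebraic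
  choose μ a b hμ ha hb hroot huniq using
    fun j => soloInformed_exists_isolating_ratInterval (halg j)
  -- coordinates: `x` first (`Fin.castAdd m`), the spread-out coefficients `y` last (`Fin.natAdd n`)
  let σ : Fin m ⊕ Fin n → Fin (n + m) := Sum.elim (Fin.natAdd n) (Fin.castAdd m)
  let G : Set (Fin (n + m) → ℝ) :=
    (⋂ j ∈ (Finset.univ : Finset (Fin m)),
      ({u | (a j : ℝ) < u (Fin.natAdd n j)} ∩ {u | u (Fin.natAdd n j) < b j}) ∩
        {u | Polynomial.aeval (u (Fin.natAdd n j)) (μ j) = 0}) ∩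
    {u | rel (MvPolynomial.aeval u (MvPolynomial.rename σ Q))}
  have hG : IsSemialgebraic ℚ G := by
    refine (IsSemialgebraic.biInter _ _ fun j _ => (IsSemialgebraic.inter ?_ ?_).inter ?_).inter
      (hrel _ _)
    · convert isSemialgebraic_setOf_eval_pos (k := ℚ) (R := ℝ)
        (MvPolynomial.X (Fin.natAdd n j) - MvPolynomial.C (a j) : MvPolynomial (Fin (n + m)) ℚ)
        using 1
      ext u
      simp [sub_pos]
    · convert isSemialgebraic_setOf_eval_pos (k := ℚ) (R := ℝ)
        (MvPolynomial.C (b j) - MvPolynomial.X (Fin.natAdd n j) : MvPolynomial (Fin (n + m)) ℚ)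
        using 1
      ext u
      simp [sub_pos]
    · convert isSemialgebraic_setOf_eval_eq_zero (k := ℚ) (R := ℝ)
        (Polynomial.aeval (MvPolynomial.X (Fin.natAdd n j) : MvPolynomial (Fin (n + m)) ℚ) (μ j))
        using 1
      ext u
      rw [mem_setOf_eq, mem_setOf_eq, ← Polynomial.aeval_algHom_apply, MvPolynomial.aeval_X]
  have hset : {x : Fin n → ℝ | rel (MvPolynomial.aeval x p)} =
      (fun u : Fin (n + m) → ℝ => fun i : Fin n => u (Fin.castAdd m i)) '' G := by
    ext x
    constructor
    · intro hx
      refine ⟨Fin.append x (fun j => algebraMap (integralClosure ℚ ℝ) ℝ (c j)), ⟨?_, ?_⟩, ?_⟩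
      · simp only [mem_iInter, mem_inter_iff, mem_setOf_eq, Fin.append_right]
        exact fun j _ => ⟨⟨ha j, hb j⟩, hroot j⟩
      · have hcomp : Fin.append x (fun j => algebraMap (integralClosure ℚ ℝ) ℝ (c j)) ∘ σ =
            Sum.elim (fun j => algebraMap (integralClosure ℚ ℝ) ℝ (c j)) x := by
          funext s
          cases s with
          | inl j => simp [σ]
          | inr i => simp [σ]
        rw [mem_setOf_eq, MvPolynomial.aeval_rename, hcomp, hQ x]
        exact hx
      · funext i
        simp
    · rintro ⟨u, ⟨hu₁, hu₂⟩, rfl⟩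
      have hc : ∀ j, u (Fin.natAdd n j) = algebraMap (integralClosure ℚ ℝ) ℝ (c j) := fun j => by
        have hj := mem_iInter.1 (mem_iInter.1 hu₁ j) (Finset.mem_univ j)
        simp only [mem_inter_iff, mem_setOf_eq] at hj
        exact huniq j _ hj.1.1 hj.1.2 hj.2
      have hcomp : u ∘ σ = Sum.elim (fun j => algebraMap (integralClosure ℚ ℝ) ℝ (c j))
          fun i => u (Fin.castAdd m i) := by
        funext s
        cases s with
        | inl j => simp [σ, hc j]
        | inr i => simp [σ]
      rw [mem_setOf_eq, ← hQ, ← hcomp, ← MvPolynomial.aeval_rename]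
      exact hu₂
  rw [hset]
  exact hG.image_castAdd

/-- **Descent of real-algebraic coefficients.** A subset of `ℝⁿ` semialgebraic over the ring
`K = integralClosure ℚ ℝ` of real algebraic numbers is `ℚ`-semialgebraic (generators by
`soloInformed_isSemialgebraic_rat_setOf_coeff`, then the Boolean operations).  With the converse
base change (`soloInformed_isSemialgebraic_baseChange` of file 1): `K`-semialgebraic `=`
`ℚ`-semialgebraic — the reading `ℝ_alg`-semialgebraic `=` `ℚ`-semialgebraic of the tree's
`IsSemialgebraic ℚ` [CressonViu2022, §1]. [cite: BasuPollackRoy2006, Thm. 2.77 and Cor. 2.78] -/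
theorem soloInformed_isSemialgebraic_rat_of_integralClosure {n : ℕ} {s : Set (Fin n → ℝ)}
    (hs : IsSemialgebraic (integralClosure ℚ ℝ) s) : IsSemialgebraic ℚ s := by
  induction hs using BooleanSubalgebra.closure_bot_sup_induction with
  | mem t ht =>
    rcases ht with ⟨p, rfl⟩ | ⟨p, rfl⟩
    · exact soloInformed_isSemialgebraic_rat_setOf_coeff (· = 0)
        (fun N q => isSemialgebraic_setOf_eval_eq_zero q) p
    · exact soloInformed_isSemialgebraic_rat_setOf_coeff (0 < ·)
        (fun N q => isSemialgebraic_setOf_eval_pos q) p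
  | bot => exact isSemialgebraic_empty
  | sup t _ u _ iht ihu => exact iht.union ihu
  | compl t _ iht => exact iht.compl

/-! ### Fibres of `ℚ`-semialgebraic families at algebraic parameters -/

/-- Specialising the parameter block of a rational polynomial `q(C, X)` at real-algebraic values
`c ∈ Kᵐ` gives a polynomial `q(c, X) ∈ K[X]` with `q(c, X)(x) = q(c, x)`. [folklore] -/
theorem soloInformed_aeval_specialise_params {m n : ℕ} (c : Fin m → integralClosure ℚ ℝ)
    (q : MvPolynomial (Fin m ⊕ Fin n) ℚ) (x : Fin n → ℝ) :
    MvPolynomial.aeval x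
        (MvPolynomial.aeval (R := ℚ)
          (Sum.elim (fun j => MvPolynomial.C (c j)) MvPolynomial.X :
            Fin m ⊕ Fin n → MvPolynomial (Fin n) (integralClosure ℚ ℝ)) q) =
      MvPolynomial.aeval (Sum.elim (fun j => algebraMap (integralClosure ℚ ℝ) ℝ (c j)) x) q := by
  let φ : MvPolynomial (Fin m ⊕ Fin n) ℚ →ₐ[ℚ] ℝ :=
    ((MvPolynomial.aeval x :
        MvPolynomial (Fin n) (integralClosure ℚ ℝ) →ₐ[integralClosure ℚ ℝ] ℝ).restrictScalars
      ℚ).comp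
      (MvPolynomial.aeval (R := ℚ)
        (Sum.elim (fun j => MvPolynomial.C (c j)) MvPolynomial.X :
          Fin m ⊕ Fin n → MvPolynomial (Fin n) (integralClosure ℚ ℝ)))
  have hφ :
      φ = MvPolynomial.aeval (Sum.elim (fun j => algebraMap (integralClosure ℚ ℝ) ℝ (c j)) x) := by
    refine MvPolynomial.algHom_ext fun s => ?_
    cases s with
    | inl j => simp [φ]
    | inr i => simp [φ]
  exact congrArg (fun ψ : MvPolynomial (Fin m ⊕ Fin n) ℚ →ₐ[ℚ] ℝ => ψ q) hφ

/-- **Fibres of `ℚ`-semialgebraic families at algebraic parameters are `ℚ`-semialgebraic.** If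
`S ⊆ ℝ^{m ⊕ n}` is `ℚ`-semialgebraic and `c ∈ ℝᵐ` has all coordinates algebraic over `ℚ`, then
`{x | (c, x) ∈ S}` is `ℚ`-semialgebraic: each generator specialises to a sign condition on a
polynomial with real-algebraic coefficients (`soloInformed_aeval_specialise_params`), which descends
(`soloInformed_isSemialgebraic_rat_setOf_coeff`).  With file 1 (`ℝ`-semialgebraic sets are such
fibres at REAL parameters, and valid parameters can be chosen algebraic) this is the step
"a certificate with algebraic parameters is a `ℚ`-certificate" of THEOREM T.
[cite: BasuPollackRoy2006, Thm. 2.80 and Cor. 2.78] -/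
theorem soloInformed_isSemialgebraic_rat_fibre_of_isAlgebraic {m n : ℕ}
    {S : Set (Fin m ⊕ Fin n → ℝ)} (hS : IsSemialgebraic ℚ S) {c : Fin m → ℝ}
    (hc : ∀ j, IsAlgebraic ℚ (c j)) : IsSemialgebraic ℚ {x : Fin n → ℝ | Sum.elim c x ∈ S} := by
  let c' : Fin m → integralClosure ℚ ℝ :=
    fun j => ⟨c j, (mem_integralClosure_iff ℚ ℝ).2 (hc j).isIntegral⟩
  have hcc : (fun j => algebraMap (integralClosure ℚ ℝ) ℝ (c' j)) = c := by
    funext j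
    rfl
  induction hS using BooleanSubalgebra.closure_bot_sup_induction with
  | mem t ht =>
    rcases ht with ⟨q, rfl⟩ | ⟨q, rfl⟩
    · convert soloInformed_isSemialgebraic_rat_setOf_coeff (· = 0)
        (fun N q => isSemialgebraic_setOf_eval_eq_zero q)
        (MvPolynomial.aeval (R := ℚ)
          (Sum.elim (fun j => MvPolynomial.C (c' j)) MvPolynomial.X :
            Fin m ⊕ Fin n → MvPolynomial (Fin n) (integralClosure ℚ ℝ)) q) using 1
      ext x
      rw [mem_setOf_eq, mem_setOf_eq, mem_setOf_eq, soloInformed_aeval_specialise_params, hcc]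
    · convert soloInformed_isSemialgebraic_rat_setOf_coeff (0 < ·)
        (fun N q => isSemialgebraic_setOf_eval_pos q)
        (MvPolynomial.aeval (R := ℚ)
          (Sum.elim (fun j => MvPolynomial.C (c' j)) MvPolynomial.X :
            Fin m ⊕ Fin n → MvPolynomial (Fin n) (integralClosure ℚ ℝ)) q) using 1
      ext x
      rw [mem_setOf_eq, mem_setOf_eq, mem_setOf_eq, soloInformed_aeval_specialise_params, hcc]
  | bot => exact isSemialgebraic_empty
  | sup t _ u _ iht ihu => exact iht.union ihu
  | compl t _ iht => exact iht.compl

/-- **Algebraic-parameter instances of `ℚ`-semialgebraic conditions are `ℚ`-semialgebraic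
conditions** — the predicate form of `soloInformed_isSemialgebraic_rat_fibre_of_isAlgebraic`: if
`{(c, x) | P c x}` is `ℚ`-semialgebraic and `c` is algebraic, `{x | P c x}` is `ℚ`-semialgebraic.
[cite: BasuPollackRoy2006, Cor. 2.78] -/
theorem soloInformed_isSemialgebraic_rat_of_algebraic_instance {m n : ℕ}
    {P : (Fin m → ℝ) → (Fin n → ℝ) → Prop}
    (hP : IsSemialgebraic ℚ
      {w : Fin m ⊕ Fin n → ℝ | P (fun j => w (Sum.inl j)) fun i => w (Sum.inr i)})
    {c : Fin m → ℝ} (hc : ∀ j, IsAlgebraic ℚ (c j)) :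
    IsSemialgebraic ℚ {x : Fin n → ℝ | P c x} := by
  have h := soloInformed_isSemialgebraic_rat_fibre_of_isAlgebraic hP hc
  refine (congrArg (IsSemialgebraic ℚ) ?_).mpr h
  ext x
  simp only [mem_setOf_eq, Sum.elim_inl, Sum.elim_inr]

end Summit.KontsevichZagierPeriods.KontsevichZagierPeriods.Theorems
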